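import Summits.PneNP.PneNP.Theorems.RootDecompSegregatorSmallSegregators.Negative.KSS4

/-!
# K\*\* — proofs 5/6 (`KSS5`)

Proof file 5/6 of the kernel refutation of the route item `RootDecompSegregator.SmallSegregators`
(stmt-PneNP-26297; deciding theorem `Summit.PneNP.PneNP.Theorems.RootDecompSegregatorSmallSegregators_refuted`
in `Theorems/RootDecompSegregatorSmallSegregatorsRefutation.lean`; definitions in `Defs.lean` of this
directory).  Topic: lemmas `arcBirth_coord` … `decode_tP`.

PROVENANCE.  Mathematics and Lean text by the decomp-pnenp cell's lens-1 lineage (work file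
`decomp-pnenp-lens-1/SegregatorPageThreshold.lean`, generations 4–5, v5 sha256 `099856e2…`, brief
`KSS-DoubleButterfly.md`): the dependency cone of its theorem `not_smallSegregators`, extracted verbatim by
the cell critic and split into files of at most 400 lines (docstrings added where missing).  No declaration
here mentions a Theses item; the chain ends in `ancestorRobust_three : AncestorRobust 3 160 12` (last file),
from which the flat refutation file concludes `¬ SmallSegregators` by the kill switch
`not_smallSegregatorsAt_of_ancestorRobust` at `r = 3`, `k = 172`.
-/

namespace Summit.PneNP.PneNP.Theorems.RootDecompSegregatorSmallSegregators.Negative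

open Relation
open StackOp

namespace TSB

section Arcs
variable {L : ℕ}

set_option maxHeartbeats 800000 in
/-- (A1, level `l+1`) on the IN-role stack of level `l+1` (`trX par`, `(l+1) % 2 = par`): the birth push
of token `x` at the C-step of level `l` (V-role there) → its P-pop at level `l+1`.  Coordinates: level `l`
has `B' = i'+1+r'`, `nblk = j'+1+m'`, the birth is C-push `i'` of block `j'`; level `l+1` has `B = i+1+r`,
`nblk = j+1+m`, the pop is P-pop `i` of block `j`; the order reversal reads
`(j'B'+i') + (jB+i) + 1 = 2^L`. -/
theorem arcBirth_coord (hL : 1 ≤ L) {par l : ℕ} (hpar : (l + 1) % 2 = par) (hl : l + 1 < 2 * L)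
    {B' j' m' i' r' B j m i r : ℕ}
    (hB' : bsz L l = B') (hn' : nblk L l = j' + 1 + m') (hir' : B' = i' + 1 + r')
    (hB : bsz L (l + 1) = B) (hn : nblk L (l + 1) = j + 1 + m) (hir : B = i + 1 + r)
    (hrev : j' * B' + i' + (j * B + i) + 1 = 2 ^ L) :
    (base L l + 3 * B' * j' + 2 * B' + i', base L (l + 1) + 3 * B * j + i) ∈
      lifoArcs (trX L par) 0 [] := by
  have hparl : l % 2 ≠ par := by intro h; omega
  have hM' : (j' + 1 + m') * B' = 2 ^ L := by rw [← hn', ← hB']; exact nblk_mul_bsz hL l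
  have hM : (j + 1 + m) * B = 2 ^ L := by rw [← hn, ← hB]; exact nblk_mul_bsz hL (l + 1)
  set PRE := initX L par ++ ((List.range l).map (levX L par)).flatten ++
    (List.replicate j' (blkV B')).flatten ++
    (List.replicate B' push ++ List.replicate B' pop ++ List.replicate i' push)
    with hPRE
  set MID := List.replicate r' push ++ (List.replicate m' (blkV B')).flatten ++
    (List.replicate j (blkI B)).flatten ++ List.replicate i pop with hMID
  set POST := (List.replicate r pop ++ List.replicate B push ++ List.replicate B pop) ++
    (List.replicate m (blkI B)).flatten ++
    ((List.range (2 * L - l - 2)).map (fun k => levX L par (l + 1 + 1 + k))).flatten ++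
    List.replicate (padLen L) skip with hPOST
  have hdec : trX L par = PRE ++ push :: (MID ++ pop :: POST) := by
    rw [trX, flatten_range_split2 (levX L par) hl,
      show levX L par l = (List.replicate (j' + 1 + m') (blkV B')).flatten by
        rw [levX, if_neg hparl, levV, hB', hn'],
      show levX L par (l + 1) = (List.replicate (j + 1 + m) (blkI B)).flatten by
        rw [levX, if_pos hpar, levI, hB, hn],
      flatten_rep_split3 (blkV B') j' m', flatten_rep_split3 (blkI B) j m]
    nth_rewrite 2 [show blkV B' = _ from hir' ▸ blkV_splitC i' r']
    nth_rewrite 2 [show blkI B = _ from hir ▸ blkI_splitP i r]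
    simp only [hPRE, hMID, hPOST, List.append_assoc, List.cons_append]
  have cV1 := (count_blkV B').1
  have cV2 := (count_blkV B').2
  have cI1 := (count_blkI B).1
  have cI2 := (count_blkI B).2
  have e1 : (j' + 1 + m') * B' = j' * B' + B' + m' * B' := by ring
  have e2 : m' * (B' + B') = m' * B' + m' * B' := by ring
  have e3 : j * (B + B) = j * B + j * B := by ring
  have hq : r' + m' * B' = j * B + i := by omega
  have hPD : PD 0 MID := by
    rw [hMID]
    refine PD_append (PD_append (PD_append (PD_replicate_push 0 r') (e := r')
      (by simp [List.count_replicate]) (PD_flatten_replicate_surplus (PD_blkV B')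
        (by rw [cV1, cV2]; omega) m' r')) (e := r' + m' * B') ?_
      (PD_flatten_replicate_deficit (B := B) (c := B) (fun d hd => PD_blkI hd)
        (by rw [cI1, cI2]) le_rfl j _ (by rw [hq]; omega))) (e := i) ?_
      (PD_replicate_pop le_rfl)
    · simp only [List.count_append, List.count_replicate, count_flatten_replicate, cV1, cV2]
      simp; omega
    · simp only [List.count_append, List.count_replicate, count_flatten_replicate, cV1, cV2, cI1, cI2]
      simp; omega
  have hbal : MID.count pop = MID.count push := by
    simp only [hMID, List.count_append, List.count_replicate, count_flatten_replicate, cV1, cV2, cI1, cI2]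
    simp; omega
  have hmem := mem_lifoArcs_match PRE MID POST 0 [] hPD hbal
  rw [← hdec] at hmem
  have h1 : PRE.length = base L l + 3 * B' * j' + 2 * B' + i' := by
    simp [hPRE, base, length_levels_lt _ (length_levX hL par)]
    ring
  have h2 : MID.length = r' + m' * (3 * B') + j * (3 * B) + i := by
    simp only [hMID, List.length_append, List.length_replicate, length_flatten_replicate,
      length_blkV, length_blkI]
  rw [zero_add, h1, h2] at hmem
  convert hmem using 2
  simp only [base]
  have e4 : 3 * 2 ^ L * (l + 1) = 3 * 2 ^ L * l + 3 * 2 ^ L := by ring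
  have e5 : m' * (3 * B') = 3 * (m' * B') := by ring
  have e6 : 3 * B' * j' = 3 * (j' * B') := by ring
  have e7 : j * (3 * B) = 3 * B * j := by ring
  omega

end Arcs

/-! ### The mirror (VERBATIM `dbMirror` + its block arithmetic, copied from the node's `section KSSCount`) -/

section MirrorCopy

variable {L lam x : ℕ}

variable {L lam x : ℕ}

/-- K\*\* cone (auxiliary lemma): `dbMirror_div_bsz`. -/
theorem dbMirror_div_bsz (L lam x : ℕ) :
    dbMirror L lam x / bsz L lam = x / bsz L lam := dbMirror_div L lam x

/-- K\*\* cone (auxiliary lemma): `dbMirror_mod_bsz`. -/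
theorem dbMirror_mod_bsz (L lam x : ℕ) :
    dbMirror L lam x % bsz L lam = bsz L lam - 1 - x % bsz L lam := dbMirror_mod L lam x

end MirrorCopy

/-! ### From coordinates to vertices: the arcs of token `x` at level `lam` -/

section TokenArcs

variable {L : ℕ}

/-- K\*\* cone (auxiliary lemma): `coords`. -/
theorem coords (hL : 1 ≤ L) (lam : ℕ) {q : ℕ} (hq : q < 2 ^ L) :
    nblk L lam = q / bsz L lam + 1 + (nblk L lam - 1 - q / bsz L lam) ∧
      bsz L lam = q % bsz L lam + 1 + (bsz L lam - 1 - q % bsz L lam) := by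
  obtain ⟨_, hi, _, hjn⟩ := block_decomp hL lam hq
  constructor <;> omega

/-- K\*\* cone (auxiliary lemma): `posOf_succ_add`. -/
theorem posOf_succ_add {lam x : ℕ} (hx : x < 2 ^ L) :
    posOf L (lam + 1) x + posOf L lam x + 1 = 2 ^ L := by
  unfold posOf
  rcases Nat.mod_two_eq_zero_or_one lam with h | h
  · have h' : ¬ (lam + 1) % 2 = 0 := by omega
    (simp [h, h']; omega)
  · have h' : (lam + 1) % 2 = 0 := by omega
    have h'' : ¬ lam % 2 = 0 := by omega
    (simp [h', h'']; omega)

/-- (a2) P → Q on the V stack. -/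
theorem arc_PQ (hL : 1 ≤ L) {par lam x : ℕ} (hpar : lam % 2 ≠ par) (hlam : lam < 2 * L)
    (hx : x < 2 ^ L) : (tP L lam x, tQ L lam x) ∈ lifoArcs (trX L par) 0 [] := by
  obtain ⟨hn, hB⟩ := coords hL lam (posOf_lt (lam := lam) hx)
  exact arcV_coord hL hpar hlam rfl hn hB

/-- (a3) Q → C on the IN stack. -/
theorem arc_QC (hL : 1 ≤ L) {par lam x : ℕ} (hpar : lam % 2 = par) (hlam : lam < 2 * L)
    (hx : x < 2 ^ L) : (tQ L lam x, tC L lam x) ∈ lifoArcs (trX L par) 0 [] := by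
  obtain ⟨hn, hB⟩ := coords hL lam (posOf_lt (lam := lam) hx)
  exact arcI_coord hL hpar hlam rfl hn hB

/-- (a4) P → partner C on `U`. -/
theorem arc_U (hL : 1 ≤ L) {lam x : ℕ} (hlam : lam < 2 * L) (hx : x < 2 ^ L) :
    (tP L lam x, tC' L lam x) ∈ lifoArcs (trU L) 0 [] := by
  obtain ⟨hn, hB⟩ := coords hL lam (posOf_lt (lam := lam) hx)
  exact arcU_coord hL hlam rfl hn hB

/-- K\*\* cone (auxiliary lemma): `beta_succ`. -/
theorem beta_succ (L lam x : ℕ) : beta L (lam + 1) x = tC L lam x := by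
  simp [beta]

/-- K\*\* cone (auxiliary lemma): `beta_zero`. -/
theorem beta_zero (L x : ℕ) : beta L 0 x = x := by simp [beta]

/-- (a1) birth → P on the IN stack, level `l+1`. -/
theorem arc_birth_succ (hL : 1 ≤ L) {par l x : ℕ} (hpar : (l + 1) % 2 = par) (hl : l + 1 < 2 * L)
    (hx : x < 2 ^ L) : (beta L (l + 1) x, tP L (l + 1) x) ∈ lifoArcs (trX L par) 0 [] := by
  obtain ⟨hn', hB'⟩ := coords hL l (posOf_lt (lam := l) hx)
  obtain ⟨hn, hB⟩ := coords hL (l + 1) (posOf_lt (lam := l + 1) hx)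
  have h1 := (block_decomp hL l (posOf_lt (lam := l) hx)).1
  have h2 := (block_decomp hL (l + 1) (posOf_lt (lam := l + 1) hx)).1
  have hrev := posOf_succ_add (L := L) (lam := l) hx
  rw [beta_succ]
  exact arcBirth_coord hL hpar hl rfl hn' hB' rfl hn hB (by rw [h1, h2]; omega)

/-- (a1) birth → P on `A`, level 0. -/
theorem arc_birth_zero (hL : 1 ≤ L) {x : ℕ} (hx : x < 2 ^ L) :
    (beta L 0 x, tP L 0 x) ∈ lifoArcs (trX L 0) 0 [] := by
  have hM : bsz L 0 = 2 ^ L := by simp [bsz]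
  have hq : posOf L 0 x = 2 ^ L - 1 - x := by simp [posOf]
  have ht : tP L 0 x = 2 ^ L + (2 ^ L - 1 - x) := by
    rw [tP, hq, hM, base, Nat.div_eq_of_lt (by omega), Nat.mod_eq_of_lt (by omega)]; ring
  rw [beta_zero, ht]
  exact arcInit_coord hL (by omega)

/-! #### The mirror identity `tC (dbMirror x) = tC' x` -/

/-- K\*\* cone (auxiliary lemma): `rev_div_mod`. -/
theorem rev_div_mod {M nb B x : ℕ} (hM : nb * B = M) (hB : 0 < B) (hx : x < M) :
    (M - 1 - x) / B = nb - 1 - x / B ∧ (M - 1 - x) % B = B - 1 - x % B := by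
  have hxd : x / B * B + x % B = x := Nat.div_add_mod' x B
  have hw : x % B < B := Nat.mod_lt _ hB
  have ha : x / B < nb := by rw [Nat.div_lt_iff_lt_mul hB, hM]; exact hx
  obtain ⟨c, hc⟩ : ∃ c, nb = x / B + 1 + c := ⟨nb - x / B - 1, by omega⟩
  have e1 : nb * B = x / B * B + B + c * B := by rw [hc]; ring
  have hrev : M - 1 - x = (B - 1 - x % B) + B * c := by
    have : M = x / B * B + B + c * B := by rw [← hM, e1]
    rw [this, mul_comm B c]; omega
  rw [hrev, Nat.add_mul_div_left _ _ hB, Nat.add_mul_mod_self_left, Nat.div_eq_of_lt (by omega),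
    Nat.mod_eq_of_lt (by omega)]
  constructor <;> omega

/-- K\*\* cone (auxiliary lemma): `posOf_dbMirror_div_mod`. -/
theorem posOf_dbMirror_div_mod (hL : 1 ≤ L) (lam : ℕ) {x : ℕ} (hx : x < 2 ^ L) :
    posOf L lam (dbMirror L lam x) / bsz L lam = posOf L lam x / bsz L lam ∧
      posOf L lam (dbMirror L lam x) % bsz L lam = bsz L lam - 1 - posOf L lam x % bsz L lam := by
  have hB : 0 < bsz L lam := bsz_pos L lam
  have hxm : dbMirror L lam x < 2 ^ L := dbMirror_lt hx
  have hdiv : dbMirror L lam x / bsz L lam = x / bsz L lam := dbMirror_div_bsz L lam x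
  have hmod : dbMirror L lam x % bsz L lam = bsz L lam - 1 - x % bsz L lam := dbMirror_mod_bsz L lam x
  unfold posOf
  split_ifs with h
  · have hMB := nblk_mul_bsz hL lam
    obtain ⟨d1, m1⟩ := rev_div_mod hMB hB hx
    obtain ⟨d2, m2⟩ := rev_div_mod hMB hB hxm
    exact ⟨by rw [d1, d2, hdiv], by rw [m1, m2, hmod]⟩
  · exact ⟨hdiv, hmod⟩

/-- K\*\* cone (auxiliary lemma): `tC_dbMirror`. -/
theorem tC_dbMirror (hL : 1 ≤ L) (lam : ℕ) {x : ℕ} (hx : x < 2 ^ L) :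
    tC L lam (dbMirror L lam x) = tC' L lam x := by
  obtain ⟨hd, hm⟩ := posOf_dbMirror_div_mod hL lam hx
  rw [tC, tC', hd, hm]

end TokenArcs

/-! ### The charged `DB(L)` system of the schedule (charge 1) -/

section Layout

open Relation

variable {L : ℕ}

/-- K\*\* cone (auxiliary lemma): `mem_tbGraph_U`. -/
theorem mem_tbGraph_U {e : ℕ × ℕ} (h : e ∈ lifoArcs (trU L) 0 []) : e ∈ tbGraph L := by
  unfold tbGraph traceGraph; simp [h]

/-- K\*\* cone (auxiliary lemma): `mem_tbGraph_X`. -/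
theorem mem_tbGraph_X {par : ℕ} (hpar : par = 0 ∨ par = 1) {e : ℕ × ℕ}
    (h : e ∈ lifoArcs (trX L par) 0 []) : e ∈ tbGraph L := by
  unfold tbGraph traceGraph
  rcases hpar with rfl | rfl <;> simp [h]

/-- K\*\* cone (auxiliary lemma): `tC_lt`. -/
theorem tC_lt (hL : 1 ≤ L) {lam x : ℕ} (hlam : lam < 2 * L) (hx : x < 2 ^ L) : tC L lam x < dbT L := by
  obtain ⟨hqd, hi, hjB, _⟩ := block_decomp hL lam (posOf_lt (lam := lam) hx)
  unfold tC base dbT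
  set B := bsz L lam
  set j := posOf L lam x / B
  set i := posOf L lam x % B
  have h1 : 2 ^ L * (lam + 1) ≤ 2 ^ L * (2 * L) := Nat.mul_le_mul_left _ hlam
  have e1 : 2 ^ L * (lam + 1) = 2 ^ L * lam + 2 ^ L := by ring
  have e2 : 2 ^ L * (2 * L) = 2 * (2 ^ L * L) := by ring
  have e3 : 3 * 2 ^ L * lam = 3 * (2 ^ L * lam) := by ring
  have e4 : 10 * 2 ^ L * L = 10 * (2 ^ L * L) := by ring
  have e5 : 3 * B * j = 3 * (j * B) := by ring
  have e6 : (j + 1) * B = j * B + B := by ring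
  omega

/-- K\*\* cone (auxiliary lemma): `beta_lt`. -/
theorem beta_lt (hL : 1 ≤ L) {lam x : ℕ} (hlam : lam ≤ 2 * L) (hx : x < 2 ^ L) : beta L lam x < dbT L := by
  rcases Nat.eq_zero_or_pos lam with rfl | hpos
  · rw [beta_zero]; unfold dbT; nlinarith [Nat.one_le_two_pow (n := L)]
  · obtain ⟨l, rfl⟩ : ∃ l, lam = l + 1 := ⟨lam - 1, by omega⟩
    rw [beta_succ]; exact tC_lt hL (by omega) hx

/-- The `path` field: straight edge `β(lam,x) → P → Q → C = β(lam+1,x)`, cross edge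
`β(lam,x) → P → C' = β(lam+1, mirror x)`. -/
theorem path_field (hL : 1 ≤ L) : ∀ lam x y, lam < 2 * L → x < 2 ^ L → (y = x ∨ y = dbMirror L lam x) →
    ∀ J : Finset ℕ, beta L lam x ∉ J → (∀ t ∈ carrier L lam x, t ∉ J) → beta L (lam + 1) y ∉ J →
      beta L lam x ∈ ancestorsAvoiding (tbGraph L) J (beta L (lam + 1) y) := by
  intro lam x y hlam hx hy J hb hc hby
  have hP : tP L lam x ∉ J := hc _ (by simp [carrier])
  have hQ : tQ L lam x ∉ J := hc _ (by simp [carrier])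
  have hpar01 : lam % 2 = 0 ∨ lam % 2 = 1 := Nat.mod_two_eq_zero_or_one lam
  have hpar01' : 1 - lam % 2 = 0 ∨ 1 - lam % 2 = 1 := by omega
  have hne : lam % 2 ≠ 1 - lam % 2 := by omega
  -- a1
  have a1 : (beta L lam x, tP L lam x) ∈ tbGraph L := by
    rcases Nat.eq_zero_or_pos lam with rfl | hpos
    · exact mem_tbGraph_X (Or.inl rfl) (arc_birth_zero hL hx)
    · obtain ⟨l, rfl⟩ : ∃ l, lam = l + 1 := ⟨lam - 1, by omega⟩
      exact mem_tbGraph_X hpar01 (arc_birth_succ hL rfl hlam hx)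
  have a2 : (tP L lam x, tQ L lam x) ∈ tbGraph L := mem_tbGraph_X hpar01' (arc_PQ hL hne hlam hx)
  have a3 : (tQ L lam x, tC L lam x) ∈ tbGraph L := mem_tbGraph_X hpar01 (arc_QC hL rfl hlam hx)
  have a4 : (tP L lam x, tC' L lam x) ∈ tbGraph L := mem_tbGraph_U (arc_U hL hlam hx)
  rcases hy with rfl | rfl
  · rw [beta_succ] at hby ⊢
    exact TransGen.tail (TransGen.tail (TransGen.single ⟨a1, hb, hP⟩) ⟨a2, hP, hQ⟩) ⟨a3, hQ, hby⟩
  · rw [beta_succ, tC_dbMirror hL lam hx] at hby ⊢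
    exact TransGen.tail (TransGen.single ⟨a1, hb, hP⟩) ⟨a4, hP, hby⟩

/-! #### Decoding a step to the unique abstract vertex charged to it -/

/-- K\*\* cone (auxiliary lemma): `decode_time`. -/
theorem decode_time (L lam : ℕ) {s : ℕ} (hs : s < 3 * 2 ^ L) :
    decode L (2 ^ L + 3 * 2 ^ L * lam + s) = decodeAux L lam s := by
  have hM : 0 < 3 * 2 ^ L := by positivity
  unfold decode
  rw [if_neg (by omega), show 2 ^ L + 3 * 2 ^ L * lam + s - 2 ^ L = s + 3 * 2 ^ L * lam by omega,
    Nat.add_mul_div_left _ _ hM, Nat.add_mul_mod_self_left, Nat.div_eq_of_lt hs, Nat.mod_eq_of_lt hs,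
    zero_add]

/-- K\*\* cone (auxiliary lemma): `decodeAux_split`. -/
theorem decodeAux_split (L lam : ℕ) {j ph i : ℕ} (hph : ph < 3) (hi : i < bsz L lam) :
    (3 * bsz L lam * j + (bsz L lam * ph + i)) / (3 * bsz L lam) = j ∧
    (3 * bsz L lam * j + (bsz L lam * ph + i)) % (3 * bsz L lam) / bsz L lam = ph ∧
    (3 * bsz L lam * j + (bsz L lam * ph + i)) % (3 * bsz L lam) % bsz L lam = i := by
  set B := bsz L lam
  have hB : 0 < B := bsz_pos L lam
  have h3B : 0 < 3 * B := by omega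
  have hoff : B * ph + i < 3 * B := by nlinarith
  rw [show 3 * B * j + (B * ph + i) = (B * ph + i) + (3 * B) * j by ring,
    Nat.add_mul_div_left _ _ h3B, Nat.add_mul_mod_self_left, Nat.div_eq_of_lt hoff,
    Nat.mod_eq_of_lt hoff, zero_add, show B * ph + i = i + B * ph by ring,
    Nat.add_mul_div_left _ _ hB, Nat.add_mul_mod_self_left, Nat.div_eq_of_lt hi, Nat.mod_eq_of_lt hi]
  exact ⟨rfl, by simp, rfl⟩

/-- K\*\* cone (auxiliary lemma): `decodeAux_P`. -/
theorem decodeAux_P (L lam : ℕ) {j i : ℕ} (hi : i < bsz L lam) :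
    decodeAux L lam (3 * bsz L lam * j + i) = (lam, posOf L lam (j * bsz L lam + i)) := by
  obtain ⟨h1, h2, h3⟩ := decodeAux_split L lam (j := j) (ph := 0) (i := i) (by norm_num) hi
  simp only [mul_zero, zero_add] at h1 h2 h3
  unfold decodeAux; rw [if_pos h2, h1, h3]

/-- K\*\* cone (auxiliary lemma): `decodeAux_Q`. -/
theorem decodeAux_Q (L lam : ℕ) {j r : ℕ} (hr : r < bsz L lam) :
    decodeAux L lam (3 * bsz L lam * j + (bsz L lam + r)) =
      (lam, posOf L lam (j * bsz L lam + (bsz L lam - 1 - r))) := by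
  obtain ⟨h1, h2, h3⟩ := decodeAux_split L lam (j := j) (ph := 1) (i := r) (by norm_num) hr
  simp only [mul_one] at h1 h2 h3
  unfold decodeAux; rw [if_neg (by omega), if_pos h2, h1, h3]

/-- K\*\* cone (auxiliary lemma): `decodeAux_C`. -/
theorem decodeAux_C (L lam : ℕ) {j i : ℕ} (hi : i < bsz L lam) :
    decodeAux L lam (3 * bsz L lam * j + (2 * bsz L lam + i)) = (lam + 1, posOf L lam (j * bsz L lam + i)) := by
  obtain ⟨h1, h2, h3⟩ := decodeAux_split L lam (j := j) (ph := 2) (i := i) (by norm_num) hi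
  rw [show bsz L lam * 2 = 2 * bsz L lam by ring] at h1 h2 h3
  unfold decodeAux; rw [if_neg (by omega), if_neg (by omega), h1, h3]

/-- K\*\* cone (auxiliary lemma): `off_lt`. -/
theorem off_lt (hL : 1 ≤ L) (lam : ℕ) {q : ℕ} (hq : q < 2 ^ L) {off : ℕ} (hoff : off < 3 * bsz L lam) :
    3 * bsz L lam * (q / bsz L lam) + off < 3 * 2 ^ L := by
  obtain ⟨_, _, hjB, _⟩ := block_decomp hL lam hq
  nlinarith

/-- K\*\* cone (auxiliary lemma): `decode_tP`. -/
theorem decode_tP (hL : 1 ≤ L) (lam : ℕ) {x : ℕ} (hx : x < 2 ^ L) : decode L (tP L lam x) = (lam, x) := by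
  have hq := posOf_lt (L := L) (lam := lam) hx
  obtain ⟨hqd, hi, hjB, _⟩ := block_decomp hL lam hq
  rw [tP, base, add_assoc (2 ^ L + 3 * 2 ^ L * lam), decode_time L lam (off_lt hL lam hq (by omega)),
    decodeAux_P L lam hi, hqd, posOf_posOf hx]

end Layout

end TSB

end Summit.PneNP.PneNP.Theorems.RootDecompSegregatorSmallSegregators.Negative
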